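import Literature.Analysis.FluidPDE.ChaeWolfLocalLeray
import HarnessLib

/-!
# Scaling-invariant representatives: extension from a fundamental domain of the DSS scaling

Analysis/FluidPDE support file for the forward discretely self-similar (DSS) existence theory of
Bradshaw–Tsai (Analysis & PDE 12 (2019), Thm 1.2; facts `bradshawTsai2019_limit_4_3_local`,
`bradshawTsai2019_cylinderLimit`). In the tree a `λ`-DSS field is a function `u : ℝ → E → F` with
the *pointwise* identity `λ u(λ²t, λx) = u(t, x)` on all of `ℝ × E` (`IsDiscretelySelfSimilar`),
whereas limits of DSS fields obtained by compactness are only DSS almost everywhere on the region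
of convergence. This file provides the passage from the latter to the former — the content of
Bradshaw–Tsai 2019, §4.2 ("if a solution is DSS in a neighborhood of the origin, then it can be
extended to a DSS solution on `ℝ³ × (0,∞)`") at the level of representatives:

* `stDilate c j` — the parabolic dilation `(t, x) ↦ (c^{2j} t, c^j x)`, `j ∈ ℤ`
  (`= stAffine (c^j)² (c^j) 0 0`);
* `topLayer c W = {w ∈ W | stDilate c 1 w ∉ W}` — for a region `W` invariant under the shrinking
  `stDilate c (-1)` (e.g. a cylinder `(0,T) × B_r`, `c ≥ 1`) this is a fundamental domain of the
  scaling on the orbit of `W`: every orbit meets it at most once (`stDilate_index_unique`), and for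
  cylinders every point with positive time does meet it (`exists_stDilate_mem_topLayer_cylinder`);
* `dssExtend c b W f` — the `b`-weighted scaling-invariant extension of `f|_{topLayer}`:
  `dssExtend … z = b^j • f (stDilate c j z)` for the index `j` with `stDilate c j z ∈ topLayer c W`
  (`0` if there is none). It satisfies `b • dssExtend (stDilate c 1 z) = dssExtend z` identically
  (`smul_dssExtend_stDilate_one`), so that with `b = c` the curried field is `c`-DSS
  (`isDiscretelySelfSimilar_dssExtend`) and with `b = c²` it is a `c`-DSS pressure
  (`nsRescalePressure_dssExtend`);
* agreement with `f`: if `f` is DSS almost everywhere on `W` in the form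
  `f (stDilate c (-1) w) = b • f w` for a.e. `w ∈ W`, then `dssExtend c b W f = f` a.e. on `W`
  (`dssExtend_ae_eq_of_ae`); and the sliced version on a cylinder — if the identity holds for
  *every* time `t ∈ (0,T)` and a.e. `x ∈ B_r`, then `dssExtend … (t, ·) = f (t, ·)` a.e. on `B_r`
  for *every* `t ∈ (0,T)` (`dssExtend_slice_ae_eq`), which is what the every-`t` datum clause of
  `IsBradshawTsai2019LocalSolution` needs.

Everything is over a real normed (for the measure theory: finite-dimensional inner product)
space `E` and a real vector space `X` of values.

## Design notes

* *Relation to `dssRepr` (`ChaeWolfLocalLeray.lean`).* The tree already has the everywhere-DSS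
  representative `dssRepr c u` (`t > 0`: `cᵏ u(c²ᵏt, cᵏx)` with `k = dssIndex c t`, the unique
  integer with `c²ᵏ t ∈ [1, c²)`; `0` for `t ≤ 0`), tailored to fields known on whole slabs
  `(0, T) × E` (Chae–Wolf's setting: slice-wise a.e. self-similarity on all of `E`). It is the
  special case `W = (0, c²) × E`, weight `b = c` of `dssExtend` (`dssRepr_eq_dssExtend`: the top
  layer of that `W` is `[1, c²) × E`). The general `W` is needed here because the limit produced by
  `bradshawTsai2019_cylinderLimit` is only known on the bounded cylinder `(0,T) × B₁`, whose
  scaling orbit is organised by the top layer `((0,T) × B₁) ∖ ((0,T/c²) × B_{1/c})`, not by time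
  alone; and the pressure needs the weight `b = c²`.
* `stDilate` is stated over a normed space (pure algebra); its identification with the tree's
  affine maps `stAffine (c^j)² (c^j) 0 0` (`stDilate_eq_stAffine`), which are set up over inner
  product spaces, imports the change-of-variables and null-set machinery of `SpaceTimeRescaling`.

## References

* Z. Bradshaw, T.-P. Tsai, *Discretely self-similar solutions to the Navier–Stokes equations with
  data in `L²_loc` satisfying the local energy inequality*, Analysis & PDE 12 (2019) =
  arXiv:1801.08060, §4.2 [BradshawTsai2019].
-/

noncomputable section

open MeasureTheory Set Function Filter Metric
open scoped ENNReal Topology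

namespace Literature.Analysis.FluidPDE

namespace BradshawTsai2019

/-! ### The parabolic dilations `stDilate c j`, `j ∈ ℤ` -/

section Dilate

variable {E : Type*} [NormedAddCommGroup E] [NormedSpace ℝ E]

/-- The parabolic dilation by `c^j`, `j ∈ ℤ`: `stDilate c j (t, x) = (c^{2j} t, c^j x)` (the
scaling `(x,t) ↦ (λ^k x, λ^{2k} t)`, `k ∈ ℤ`, of Bradshaw–Tsai 2019, §3 and §4.2, time first). [cite: BradshawTsai2019, §4.2] -/
def stDilate (c : ℝ) (j : ℤ) (z : ℝ × E) : ℝ × E :=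
  ((c ^ j) ^ 2 * z.1, (c ^ j) • z.2)

/-- Unfolding `stDilate`. [folklore] -/
@[simp]
theorem stDilate_apply (c : ℝ) (j : ℤ) (t : ℝ) (x : E) :
    stDilate c j (t, x) = ((c ^ j) ^ 2 * t, (c ^ j) • x) :=
  rfl

/-- First component of `stDilate`. [folklore] -/
@[simp]
theorem stDilate_fst (c : ℝ) (j : ℤ) (z : ℝ × E) : (stDilate c j z).1 = (c ^ j) ^ 2 * z.1 :=
  rfl

/-- Second component of `stDilate`. [folklore] -/
@[simp]
theorem stDilate_snd (c : ℝ) (j : ℤ) (z : ℝ × E) : (stDilate c j z).2 = (c ^ j) • z.2 :=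
  rfl

/-- `stDilate c 0 = id`. [folklore] -/
@[simp]
theorem stDilate_zero (c : ℝ) (z : ℝ × E) : stDilate c 0 z = z := by
  rcases z with ⟨t, x⟩
  simp [stDilate]

/-- Group law: `stDilate c (i + j) = stDilate c i ∘ stDilate c j` (`c ≠ 0`). [folklore] -/
theorem stDilate_add {c : ℝ} (hc : c ≠ 0) (i j : ℤ) (z : ℝ × E) :
    stDilate c (i + j) z = stDilate c i (stDilate c j z) := by
  rcases z with ⟨t, x⟩
  simp only [stDilate_apply, zpow_add₀ hc, mul_pow, mul_assoc, mul_smul]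

/-- `stDilate c 1 (t, x) = (c² t, c x)`. [folklore] -/
theorem stDilate_one (c : ℝ) (t : ℝ) (x : E) : stDilate c 1 (t, x) = (c ^ 2 * t, c • x) := by
  simp

/-- `stDilate c (-1)` undoes `stDilate c 1` (`c ≠ 0`). [folklore] -/
theorem stDilate_neg_one_stDilate_one {c : ℝ} (hc : c ≠ 0) (z : ℝ × E) :
    stDilate c (-1) (stDilate c 1 z) = z := by
  rw [← stDilate_add hc, neg_add_cancel, stDilate_zero]

/-- `stDilate c 1` undoes `stDilate c (-1)` (`c ≠ 0`). [folklore] -/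
theorem stDilate_one_stDilate_neg_one {c : ℝ} (hc : c ≠ 0) (z : ℝ × E) :
    stDilate c 1 (stDilate c (-1) z) = z := by
  rw [← stDilate_add hc, add_neg_cancel, stDilate_zero]

/-- The time of `stDilate c j z` is positive iff the time of `z` is (`c ≠ 0`). [folklore] -/
theorem stDilate_fst_pos {c : ℝ} (hc : c ≠ 0) {j : ℤ} {z : ℝ × E} :
    0 < (stDilate c j z).1 ↔ 0 < z.1 := by
  rw [stDilate_fst]
  exact mul_pos_iff_of_pos_left (by positivity)

/-- A `c`-DSS velocity at the shrunk point: `u (t/c², x/c) = c • u (t, x)`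
(`IsDiscretelySelfSimilar c u`, `c ≠ 0`), in `stDilate` form. [folklore] -/
theorem apply_stDilate_neg_one_of_isDiscretelySelfSimilar {F : Type*} [NormedAddCommGroup F]
    [NormedSpace ℝ F] {c : ℝ} (hc : c ≠ 0) {u : ℝ → E → F} (h : IsDiscretelySelfSimilar c u)
    (w : ℝ × E) : uncurry u (stDilate c (-1) w) = c • uncurry u w := by
  rcases w with ⟨t, x⟩
  have key := congrFun (congrFun h ((c ^ (-1 : ℤ)) ^ 2 * t)) ((c ^ (-1 : ℤ)) • x)
  rw [nsRescale_apply] at key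
  have e1 : c ^ 2 * ((c ^ (-1 : ℤ)) ^ 2 * t) = t := by
    rw [zpow_neg, zpow_one, inv_pow, mul_inv_cancel_left₀ (pow_ne_zero 2 hc)]
  have e2 : c • (c ^ (-1 : ℤ)) • x = x := by
    rw [zpow_neg, zpow_one, smul_inv_smul₀ hc]
  rw [e1, e2] at key
  simp only [uncurry_apply_pair, stDilate_apply]
  exact key.symm

/-- A `c`-DSS pressure at the shrunk point: `p (t/c², x/c) = c² p (t, x)`
(`nsRescalePressure c p = p`, `c ≠ 0`), in `stDilate` form. [folklore] -/
theorem apply_stDilate_neg_one_of_nsRescalePressure {c : ℝ} (hc : c ≠ 0) {p : ℝ → E → ℝ}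
    (h : nsRescalePressure c p = p) (w : ℝ × E) :
    uncurry p (stDilate c (-1) w) = c ^ 2 * uncurry p w := by
  rcases w with ⟨t, x⟩
  have key := congrFun (congrFun h ((c ^ (-1 : ℤ)) ^ 2 * t)) ((c ^ (-1 : ℤ)) • x)
  rw [nsRescalePressure_apply] at key
  have e1 : c ^ 2 * ((c ^ (-1 : ℤ)) ^ 2 * t) = t := by
    rw [zpow_neg, zpow_one, inv_pow, mul_inv_cancel_left₀ (pow_ne_zero 2 hc)]
  have e2 : c • (c ^ (-1 : ℤ)) • x = x := by
    rw [zpow_neg, zpow_one, smul_inv_smul₀ hc]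
  rw [e1, e2] at key
  simp only [uncurry_apply_pair, stDilate_apply]
  exact key.symm

/-! ### The fundamental domain `topLayer` and the orbit index -/

/-- The **top layer** of a region `W ⊆ ℝ × E` for the scaling by `c`:
`topLayer c W = {w ∈ W | stDilate c 1 w ∉ W}`. For `W` invariant under the shrinking
`stDilate c (-1)` (a cylinder `(0,T) × B_r` when `c ≥ 1`) it is a fundamental domain of the
scaling on `⋃_j stDilate c j (W)` (Bradshaw–Tsai 2019, §4.2: a DSS solution is determined by its
values near the origin). [cite: BradshawTsai2019, §4.2] -/
def topLayer (c : ℝ) (W : Set (ℝ × E)) : Set (ℝ × E) :=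
  {w ∈ W | stDilate c 1 w ∉ W}

/-- Membership in the top layer. [folklore] -/
theorem mem_topLayer {c : ℝ} {W : Set (ℝ × E)} {w : ℝ × E} :
    w ∈ topLayer c W ↔ w ∈ W ∧ stDilate c 1 w ∉ W :=
  Iff.rfl

/-- The top layer lies in `W`. [folklore] -/
theorem topLayer_subset (c : ℝ) (W : Set (ℝ × E)) : topLayer c W ⊆ W := fun _ h => h.1

variable {c : ℝ} {W : Set (ℝ × E)}

/-- Shrink-invariance iterates: `stDilate c (-n) w ∈ W` for `w ∈ W`, `n ∈ ℕ`. [folklore] -/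
theorem stDilate_neg_natCast_mem (hc : c ≠ 0) (hW : ∀ w ∈ W, stDilate c (-1) w ∈ W) {w : ℝ × E}
    (hw : w ∈ W) (n : ℕ) : stDilate c (-(n : ℤ)) w ∈ W := by
  induction n with
  | zero => simpa using hw
  | succ n ih =>
    have e : (-((n + 1 : ℕ) : ℤ)) = -1 + -(n : ℤ) := by push_cast; ring
    rw [e, stDilate_add hc]
    exact hW _ ih

/-- The orbit indices hitting a shrink-invariant `W` form a down-set:
`stDilate c j z ∈ W`, `i ≤ j` ⟹ `stDilate c i z ∈ W`. [folklore] -/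
theorem stDilate_mem_of_le (hc : c ≠ 0) (hW : ∀ w ∈ W, stDilate c (-1) w ∈ W) {z : ℝ × E}
    {i j : ℤ} (hj : stDilate c j z ∈ W) (hij : i ≤ j) : stDilate c i z ∈ W := by
  obtain ⟨n, hn⟩ := Int.exists_add_of_le hij
  have e : i = -(n : ℤ) + j := by omega
  rw [e, stDilate_add hc]
  exact stDilate_neg_natCast_mem hc hW hj n

/-- **Uniqueness of the orbit index**: an orbit of the scaling meets the top layer of a
shrink-invariant region at most once. [folklore] -/
theorem stDilate_index_unique (hc : c ≠ 0) (hW : ∀ w ∈ W, stDilate c (-1) w ∈ W) {z : ℝ × E}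
    {i j : ℤ} (hi : stDilate c i z ∈ topLayer c W) (hj : stDilate c j z ∈ topLayer c W) :
    i = j := by
  by_contra hne
  wlog hlt : i < j generalizing i j
  · exact this hj hi (Ne.symm hne) (lt_of_le_of_ne (not_lt.1 hlt) (Ne.symm hne))
  have h1 : stDilate c (i + 1) z ∈ W := stDilate_mem_of_le hc hW hj.1 (by omega)
  rw [add_comm, stDilate_add hc] at h1
  exact hi.2 h1

/-- For `z ∈ W` an orbit index is nonnegative. [folklore] -/
theorem index_nonneg_of_mem (hc : c ≠ 0) (hW : ∀ w ∈ W, stDilate c (-1) w ∈ W) {z : ℝ × E}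
    (hz : z ∈ W) {j : ℤ} (hj : stDilate c j z ∈ topLayer c W) : 0 ≤ j := by
  by_contra hneg
  have h1 : stDilate c (j + 1) z ∈ W :=
    stDilate_mem_of_le hc hW (j := 0) (by simpa using hz) (by omega)
  rw [add_comm, stDilate_add hc] at h1
  exact hj.2 h1

/-! ### The scaling-invariant extension `dssExtend` -/

variable {X : Type*} [AddCommGroup X] [Module ℝ X]

open Classical in
/-- **The scaling-invariant extension from the top layer.** For a weight `b` and values
`f : ℝ × E → X`: `dssExtend c b W f z = b^j • f (stDilate c j z)` where `j ∈ ℤ` is such that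
`stDilate c j z ∈ topLayer c W` (unique for shrink-invariant `W`, `stDilate_index_unique`), and `0`
if the orbit of `z` misses the top layer. With `b = c` this is the `c`-DSS velocity, with `b = c²`
the `c`-DSS pressure determined by its values on the fundamental domain (Bradshaw–Tsai 2019, §4.2:
extension of a solution that is DSS near the origin). [cite: BradshawTsai2019, §4.2] -/
def dssExtend (c b : ℝ) (W : Set (ℝ × E)) (f : ℝ × E → X) (z : ℝ × E) : X :=
  if h : ∃ j : ℤ, stDilate c j z ∈ topLayer c W then b ^ h.choose • f (stDilate c h.choose z)
  else 0

variable {b : ℝ} {f : ℝ × E → X}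

/-- The value of the extension at a point whose orbit meets the top layer at index `j`. [folklore] -/
theorem dssExtend_eq_of_mem (hc : c ≠ 0) (hW : ∀ w ∈ W, stDilate c (-1) w ∈ W) {z : ℝ × E}
    {j : ℤ} (hj : stDilate c j z ∈ topLayer c W) :
    dssExtend c b W f z = b ^ j • f (stDilate c j z) := by
  classical
  have h : ∃ j : ℤ, stDilate c j z ∈ topLayer c W := ⟨j, hj⟩
  rw [dssExtend, dif_pos h]
  have e : h.choose = j := stDilate_index_unique hc hW h.choose_spec hj
  rw [e]

/-- On the top layer the extension is `f`. [folklore] -/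
theorem dssExtend_eq_self (hc : c ≠ 0) (hW : ∀ w ∈ W, stDilate c (-1) w ∈ W) {z : ℝ × E}
    (hz : z ∈ topLayer c W) : dssExtend c b W f z = f z := by
  rw [dssExtend_eq_of_mem hc hW (j := 0) (by simpa using hz)]
  simp

/-- If the orbit misses the top layer the extension vanishes. [folklore] -/
theorem dssExtend_eq_zero {z : ℝ × E} (h : ∀ j : ℤ, stDilate c j z ∉ topLayer c W) :
    dssExtend c b W f z = 0 := by
  classical
  rw [dssExtend, dif_neg (by push Not; exact h)]

/-- **The extension is scaling-invariant**: `b • dssExtend (stDilate c 1 z) = dssExtend z` for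
every `z` (`b, c ≠ 0`). [folklore] -/
theorem smul_dssExtend_stDilate_one (hc : c ≠ 0) (hb : b ≠ 0)
    (hW : ∀ w ∈ W, stDilate c (-1) w ∈ W) (z : ℝ × E) :
    b • dssExtend c b W f (stDilate c 1 z) = dssExtend c b W f z := by
  by_cases h : ∃ j : ℤ, stDilate c j z ∈ topLayer c W
  · obtain ⟨j, hj⟩ := h
    have hj' : stDilate c (j - 1) (stDilate c 1 z) ∈ topLayer c W := by
      rwa [← stDilate_add hc, sub_add_cancel]
    rw [dssExtend_eq_of_mem hc hW hj, dssExtend_eq_of_mem hc hW hj', ← stDilate_add hc,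
      sub_add_cancel, smul_smul, mul_comm, ← zpow_add_one₀ hb, sub_add_cancel]
  · push Not at h
    have h' : ∀ j : ℤ, stDilate c j (stDilate c 1 z) ∉ topLayer c W := fun j hj =>
      h (j + 1) (by rwa [stDilate_add hc])
    rw [dssExtend_eq_zero h, dssExtend_eq_zero h', smul_zero]

/-- **The extended velocity is `c`-DSS** (weight `b = c`): `c • u(c²t, cx) = u(t, x)` on all of
`ℝ × E` for `u = curry (dssExtend c c W f)`. [cite: BradshawTsai2019, §4.2] -/
theorem isDiscretelySelfSimilar_dssExtend {F : Type*} [NormedAddCommGroup F] [NormedSpace ℝ F]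
    (hc : c ≠ 0) (hW : ∀ w ∈ W, stDilate c (-1) w ∈ W) (f : ℝ × E → F) :
    IsDiscretelySelfSimilar c (fun t x => dssExtend c c W f (t, x)) := by
  funext t x
  rw [nsRescale_apply]
  have := smul_dssExtend_stDilate_one (b := c) (f := f) hc hc hW (t, x)
  rwa [stDilate_one] at this

/-- **The extended pressure is `c`-DSS** (weight `b = c²`): `c² p(c²t, cx) = p(t, x)` on all of
`ℝ × E` for `p = curry (dssExtend c (c²) W g)`. [cite: BradshawTsai2019, §4.2] -/
theorem nsRescalePressure_dssExtend (hc : c ≠ 0) (hW : ∀ w ∈ W, stDilate c (-1) w ∈ W)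
    (g : ℝ × E → ℝ) :
    nsRescalePressure c (fun t x => dssExtend c (c ^ 2) W g (t, x)) =
      fun t x => dssExtend c (c ^ 2) W g (t, x) := by
  funext t x
  rw [nsRescalePressure_apply]
  have := smul_dssExtend_stDilate_one (b := c ^ 2) (f := g) hc (pow_ne_zero 2 hc) hW (t, x)
  rwa [stDilate_one, smul_eq_mul] at this

end Dilate

/-! ### Cylinders: shrink-invariance and existence of the orbit index -/

section Cylinder

variable {E : Type*} [NormedAddCommGroup E] [NormedSpace ℝ E]

/-- A forward cylinder `(0, T) × B_r(0)` is invariant under the shrinking `stDilate c (-1)` when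
`1 ≤ c`. [folklore] -/
theorem stDilate_neg_one_mem_cylinder {c : ℝ} (hc : 1 ≤ c) (T r : ℝ) :
    ∀ w ∈ Ioo (0 : ℝ) T ×ˢ ball (0 : E) r, stDilate c (-1) w ∈ Ioo (0 : ℝ) T ×ˢ ball (0 : E) r := by
  rintro ⟨t, x⟩ ⟨⟨ht0, htT⟩, hx⟩
  have hc0 : 0 < c := one_pos.trans_le hc
  have hci : 0 < c⁻¹ := inv_pos.2 hc0
  have hci1 : c⁻¹ ≤ 1 := inv_le_one_of_one_le₀ hc
  rw [mem_ball_zero_iff] at hx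
  simp only [stDilate_apply, zpow_neg, zpow_one, mem_prod, mem_Ioo, mem_ball_zero_iff, norm_smul,
    Real.norm_eq_abs, abs_of_pos hci]
  refine ⟨⟨by positivity, ?_⟩, ?_⟩
  · calc c⁻¹ ^ 2 * t ≤ 1 * t := by
          apply mul_le_mul_of_nonneg_right _ ht0.le
          exact pow_le_one₀ hci.le hci1
      _ < T := by rwa [one_mul]
  · calc c⁻¹ * ‖x‖ ≤ 1 * ‖x‖ := mul_le_mul_of_nonneg_right hci1 (norm_nonneg _)
      _ < r := by rwa [one_mul]

/-- **Existence of the orbit index on a cylinder**: for `c > 1`, `T > 0`, `r > 0`, the orbit of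
every point with positive time meets the top layer of `(0, T) × B_r` (Bradshaw–Tsai 2019, §4.2:
every compact part of `ℝ³ × (0,∞)` is carried into the cylinder by the scaling). [cite: BradshawTsai2019, §4.2] -/
theorem exists_stDilate_mem_topLayer_cylinder {c : ℝ} (hc : 1 < c) {T r : ℝ} (hT : 0 < T)
    (hr : 0 < r) {z : ℝ × E} (hz : 0 < z.1) :
    ∃ j : ℤ, stDilate c j z ∈ topLayer c (Ioo (0 : ℝ) T ×ˢ ball (0 : E) r) := by
  rcases z with ⟨t, x⟩
  simp only at hz
  have hc0 : 0 < c := one_pos.trans hc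
  have hc0' : c ≠ 0 := hc0.ne'
  set W : Set (ℝ × E) := Ioo (0 : ℝ) T ×ˢ ball (0 : E) r with hWdef
  -- membership of `stDilate c j (t, x)` in `W`
  have hmem : ∀ j : ℤ, stDilate c j (t, x) ∈ W ↔ (c ^ j) ^ 2 * t < T ∧ c ^ j * ‖x‖ < r := by
    intro j
    have hcj : 0 < c ^ j := zpow_pos hc0 j
    simp only [stDilate_apply, hWdef, mem_prod, mem_Ioo, mem_ball_zero_iff, norm_smul,
      Real.norm_eq_abs, abs_of_pos hcj]
    constructor
    · rintro ⟨⟨-, h1⟩, h2⟩; exact ⟨h1, h2⟩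
    · rintro ⟨h1, h2⟩; exact ⟨⟨by positivity, h1⟩, h2⟩
  -- the index set is nonempty …
  have hne : ∃ j : ℤ, stDilate c j (t, x) ∈ W := by
    set ε : ℝ := min 1 (min (T / t) (r / (‖x‖ + 1))) with hε
    have hεpos : 0 < ε := by positivity
    obtain ⟨n, hn⟩ := exists_pow_lt_of_lt_one hεpos (inv_lt_one_of_one_lt₀ hc)
    refine ⟨-(n : ℤ), (hmem _).2 ?_⟩
    have e : c ^ (-(n : ℤ)) = c⁻¹ ^ n := by rw [zpow_neg, zpow_natCast, inv_pow]
    rw [e]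
    have ha0 : 0 < c⁻¹ ^ n := pow_pos (inv_pos.2 hc0) n
    have ha1 : c⁻¹ ^ n < 1 := hn.trans_le (min_le_left _ _)
    have haT : c⁻¹ ^ n < T / t := hn.trans_le ((min_le_right _ _).trans (min_le_left _ _))
    have har : c⁻¹ ^ n < r / (‖x‖ + 1) :=
      hn.trans_le ((min_le_right _ _).trans (min_le_right _ _))
    constructor
    · calc (c⁻¹ ^ n) ^ 2 * t ≤ c⁻¹ ^ n * t := by
            rw [sq, mul_assoc]
            exact mul_le_of_le_one_left (by positivity) ha1.le
        _ < T / t * t := mul_lt_mul_of_pos_right haT hz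
        _ = T := div_mul_cancel₀ T hz.ne'
    · calc c⁻¹ ^ n * ‖x‖ ≤ c⁻¹ ^ n * (‖x‖ + 1) :=
            mul_le_mul_of_nonneg_left (le_add_of_nonneg_right zero_le_one) ha0.le
        _ < r / (‖x‖ + 1) * (‖x‖ + 1) := mul_lt_mul_of_pos_right har (by positivity)
        _ = r := div_mul_cancel₀ r (by positivity)
  -- … and bounded above
  have hbdd : ∃ N : ℤ, ∀ j : ℤ, stDilate c j (t, x) ∈ W → j ≤ N := by
    obtain ⟨N, hN⟩ := pow_unbounded_of_one_lt (T / t) hc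
    refine ⟨N, fun j hj => ?_⟩
    by_contra hlt
    push Not at hlt
    have h1 : c ^ (N : ℤ) ≤ c ^ j := zpow_le_zpow_right₀ hc.le hlt.le
    rw [zpow_natCast] at h1
    have h2 : 1 ≤ c ^ j := (one_le_pow₀ hc.le).trans h1
    have h3 : T / t < (c ^ j) ^ 2 := by
      calc T / t < c ^ N := hN
        _ ≤ c ^ j := h1
        _ ≤ (c ^ j) ^ 2 := by rw [sq]; exact le_mul_of_one_le_right (by positivity) h2
    have h4 := ((hmem j).1 hj).1
    rw [div_lt_iff₀ hz] at h3
    exact absurd h4 (not_lt.2 h3.le)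
  obtain ⟨j, hj, hjmax⟩ := Int.exists_greatest_of_bdd hbdd hne
  refine ⟨j, hj, fun h1 => ?_⟩
  rw [← stDilate_add hc0'] at h1
  have := hjmax _ h1
  omega

/-- The slab `(0, T) × E` is invariant under the shrinking `stDilate c (-1)` when `1 ≤ c`. [folklore] -/
theorem stDilate_neg_one_mem_slab {c : ℝ} (hc : 1 ≤ c) (T : ℝ) :
    ∀ w ∈ Ioo (0 : ℝ) T ×ˢ (univ : Set E), stDilate c (-1) w ∈ Ioo (0 : ℝ) T ×ˢ (univ : Set E) := by
  rintro ⟨t, x⟩ ⟨⟨ht0, htT⟩, -⟩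
  have hc0 : 0 < c := one_pos.trans_le hc
  have hci : 0 < c⁻¹ := inv_pos.2 hc0
  have hci1 : c⁻¹ ≤ 1 := inv_le_one_of_one_le₀ hc
  simp only [stDilate_apply, zpow_neg, zpow_one, mem_prod, mem_Ioo, mem_univ, and_true]
  refine ⟨by positivity, ?_⟩
  calc c⁻¹ ^ 2 * t ≤ 1 * t := by
        apply mul_le_mul_of_nonneg_right _ ht0.le
        exact pow_le_one₀ hci.le hci1
    _ < T := by rwa [one_mul]

/-- **`dssRepr` is `dssExtend` for the slab `W = (0, c²) × E` with weight `c`** (`c > 1`): the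
top layer of this `W` is `[1, c²) × E`, met by the orbit of `(t, x)`, `t > 0`, exactly at the index
`dssIndex c t` (`one_le_zpow_dssIndex_sq_mul`); for `t ≤ 0` no orbit point has positive time and
both sides vanish. [folklore] -/
theorem dssRepr_eq_dssExtend {F : Type*} [NormedAddCommGroup F] [NormedSpace ℝ F] {c : ℝ}
    (hc : 1 < c) (u : ℝ → E → F) (t : ℝ) (x : E) :
    dssRepr c u t x = dssExtend c c (Ioo (0 : ℝ) (c ^ 2) ×ˢ (univ : Set E)) (uncurry u) (t, x) := by
  have hc0 : 0 < c := one_pos.trans hc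
  have hc0' : c ≠ 0 := hc0.ne'
  have hW := stDilate_neg_one_mem_slab (E := E) hc.le (c ^ 2)
  rcases le_or_gt t 0 with ht | ht
  · rw [dssRepr_of_nonpos c u ht, dssExtend_eq_zero]
    · rfl
    · intro j hj
      have h1 : 0 < (stDilate c j (t, x)).1 := hj.1.1.1
      rw [stDilate_fst_pos hc0'] at h1
      exact absurd h1 (not_lt.2 ht)
  · set k : ℤ := dssIndex c t with hk
    obtain ⟨h1, h2⟩ := one_le_zpow_dssIndex_sq_mul hc ht
    have hmem : stDilate c k (t, x) ∈ topLayer c (Ioo (0 : ℝ) (c ^ 2) ×ˢ (univ : Set E)) := by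
      refine ⟨⟨⟨by simp only [stDilate_fst]; positivity, h2⟩, mem_univ _⟩, fun h3 => ?_⟩
      have h4 : c ^ 2 * ((c ^ k) ^ 2 * t) < c ^ 2 := by
        have e : (stDilate c 1 (stDilate c k (t, x))).1 = c ^ 2 * ((c ^ k) ^ 2 * t) := by
          simp
        have := h3.1.2
        rwa [e] at this
      have h5 : c ^ 2 * 1 ≤ c ^ 2 * ((c ^ k) ^ 2 * t) := mul_le_mul_of_nonneg_left h1 (by positivity)
      rw [mul_one] at h5
      exact absurd h4 (not_lt.2 h5)
    rw [dssExtend_eq_of_mem hc0' hW hmem, dssRepr_apply_of_pos c u ht]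
    rfl

end Cylinder

/-! ### Agreement almost everywhere -/

section AE

variable {E : Type*} [NormedAddCommGroup E] [InnerProductSpace ℝ E] [FiniteDimensional ℝ E]
  [MeasurableSpace E] [BorelSpace E]
variable {X : Type*} [AddCommGroup X] [Module ℝ X]

omit [FiniteDimensional ℝ E] [MeasurableSpace E] [BorelSpace E] in
/-- `stDilate c j` is the space–time affine map `stAffine (c^j)² (c^j) 0 0`. [folklore] -/
theorem stDilate_eq_stAffine (c : ℝ) (j : ℤ) :
    (stDilate c j : ℝ × E → ℝ × E) = stAffine ((c ^ j) ^ 2) (c ^ j) 0 (0 : E) := by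
  funext z
  rcases z with ⟨t, x⟩
  simp [stDilate, stAffine]

/-- The dilations preserve Lebesgue-null sets: a.e. statements pull back along `stDilate c j`
(`c > 0`). [folklore] -/
theorem ae_comp_stDilate {c : ℝ} (hc : 0 < c) {P : ℝ × E → Prop} (h : ∀ᵐ z ∂volume, P z)
    (j : ℤ) : ∀ᵐ z ∂volume, P (stDilate c j z) := by
  rw [stDilate_eq_stAffine]
  exact (quasiMeasurePreserving_stAffine (E := E) (by positivity) (zpow_pos hc j) 0 0).ae h

variable {c b : ℝ} {W : Set (ℝ × E)} {f : ℝ × E → X}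

/-- Iterating an a.e. DSS identity on a shrink-invariant region: if
`f (stDilate c (-1) w) = b • f w` for a.e. `w ∈ W`, then for a.e. `z` and every `n ∈ ℕ` with
`stDilate c n z ∈ W`, `f z = bⁿ • f (stDilate c n z)`. [folklore] -/
theorem ae_forall_eq_pow_smul_of_ae (hc : 0 < c) (hW : ∀ w ∈ W, stDilate c (-1) w ∈ W)
    (hae : ∀ᵐ w ∂volume, w ∈ W → f (stDilate c (-1) w) = b • f w) :
    ∀ᵐ z ∂volume, ∀ n : ℕ, stDilate c (n : ℤ) z ∈ W → f z = b ^ n • f (stDilate c (n : ℤ) z) := by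
  have hc0 : c ≠ 0 := hc.ne'
  rw [ae_all_iff]
  intro n
  induction n with
  | zero => exact Eventually.of_forall fun z _ => by simp
  | succ n ih =>
    have htr := ae_comp_stDilate (E := E) hc hae ((n : ℤ) + 1)
    filter_upwards [ih, htr] with z hz hz' hmem
    have e1 : ((n + 1 : ℕ) : ℤ) = (n : ℤ) + 1 := by push_cast; ring
    rw [e1] at hmem ⊢
    have hn : stDilate c (n : ℤ) z ∈ W := by
      have := hW _ hmem
      rwa [← stDilate_add hc0, show (-1 : ℤ) + ((n : ℤ) + 1) = n by ring] at this
    have key := hz' hmem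
    rw [← stDilate_add hc0, show (-1 : ℤ) + ((n : ℤ) + 1) = n by ring] at key
    rw [hz hn, key, smul_smul, ← pow_succ]

/-- **Agreement a.e.**: if `f` is DSS almost everywhere on the shrink-invariant region `W`
(`f (stDilate c (-1) w) = b • f w` for a.e. `w ∈ W`) and every orbit from `W` meets the top layer,
then the scaling-invariant extension of `f|_{topLayer}` equals `f` a.e. on `W`. [folklore] -/
theorem dssExtend_ae_eq_of_ae (hc : 0 < c) (hW : ∀ w ∈ W, stDilate c (-1) w ∈ W)
    (hex : ∀ z ∈ W, ∃ j : ℤ, stDilate c j z ∈ topLayer c W)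
    (hae : ∀ᵐ w ∂volume, w ∈ W → f (stDilate c (-1) w) = b • f w) :
    ∀ᵐ z ∂volume, z ∈ W → dssExtend c b W f z = f z := by
  have hc0 : c ≠ 0 := hc.ne'
  filter_upwards [ae_forall_eq_pow_smul_of_ae hc hW hae] with z hz hzW
  obtain ⟨j, hj⟩ := hex z hzW
  obtain ⟨n, rfl⟩ := Int.eq_ofNat_of_zero_le (index_nonneg_of_mem hc0 hW hzW hj)
  rw [dssExtend_eq_of_mem hc0 hW hj, zpow_natCast, hz n hj.1]

/-- Space dilations preserve Lebesgue-null sets on `E`: a.e. statements pull back along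
`x ↦ γ • x` (`γ > 0`). [folklore] -/
theorem ae_comp_smul {γ : ℝ} (hγ : 0 < γ) {P : E → Prop} (h : ∀ᵐ x ∂volume, P x) :
    ∀ᵐ x ∂volume, P (γ • x) := by
  have hq : Measure.QuasiMeasurePreserving (fun x : E => γ • x) volume volume := by
    refine ⟨measurable_const_smul γ, ?_⟩
    rw [Measure.map_addHaar_smul volume hγ.ne']
    exact Measure.smul_absolutelyContinuous
  exact hq.ae h

/-- Sliced iteration on a cylinder: if for *every* `t ∈ (0, T)` the DSS identity
`f (t/c², x/c) = b • f (t, x)` holds for a.e. `x ∈ B_r`, then for every `t ∈ (0,T)`, a.e. `x`, and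
every `n ∈ ℕ` with `(c^{2n} t, c^n x) ∈ (0,T) × B_r`: `f (t, x) = bⁿ • f (c^{2n} t, c^n x)`. [folklore] -/
theorem slice_ae_forall_eq_pow_smul (hc : 1 < c) {T r : ℝ}
    (hsl : ∀ t ∈ Ioo (0 : ℝ) T, ∀ᵐ x ∂volume, x ∈ ball (0 : E) r →
      f (stDilate c (-1) (t, x)) = b • f (t, x))
    (t : ℝ) :
    ∀ᵐ x ∂volume, ∀ n : ℕ, stDilate c (n : ℤ) (t, x) ∈ Ioo (0 : ℝ) T ×ˢ ball (0 : E) r →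
      f (t, x) = b ^ n • f (stDilate c (n : ℤ) (t, x)) := by
  have hc0 : 0 < c := one_pos.trans hc
  have hc0' : c ≠ 0 := hc0.ne'
  rw [ae_all_iff]
  intro n
  induction n with
  | zero => exact Eventually.of_forall fun x _ => by simp
  | succ n ih =>
    -- the time level `s = c^{2(n+1)} t`
    set s : ℝ := (c ^ ((n : ℤ) + 1)) ^ 2 * t with hs
    by_cases hsT : s ∈ Ioo (0 : ℝ) T
    · have htr := ae_comp_smul (E := E) (zpow_pos hc0 ((n : ℤ) + 1)) (hsl s hsT)
      filter_upwards [ih, htr] with x hx hx' hmem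
      have e1 : ((n + 1 : ℕ) : ℤ) = (n : ℤ) + 1 := by push_cast; ring
      rw [e1] at hmem ⊢
      have hmem' : c ^ ((n : ℤ) + 1) • x ∈ ball (0 : E) r := hmem.2
      have key := hx' hmem'
      have e2 : stDilate c (-1) (s, c ^ ((n : ℤ) + 1) • x) = stDilate c (n : ℤ) (t, x) := by
        have : ((s, c ^ ((n : ℤ) + 1) • x) : ℝ × E) = stDilate c ((n : ℤ) + 1) (t, x) := by
          simp [hs]
        rw [this, ← stDilate_add hc0', show (-1 : ℤ) + ((n : ℤ) + 1) = n by ring]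
      rw [e2] at key
      have hn : stDilate c (n : ℤ) (t, x) ∈ Ioo (0 : ℝ) T ×ˢ ball (0 : E) r := by
        have := stDilate_neg_one_mem_cylinder hc.le T r _ hmem
        rwa [← stDilate_add hc0', show (-1 : ℤ) + ((n : ℤ) + 1) = n by ring] at this
      rw [hx hn, key, smul_smul, ← pow_succ]
      simp [hs]
    · refine Eventually.of_forall fun x hmem => absurd ?_ hsT
      have e1 : ((n + 1 : ℕ) : ℤ) = (n : ℤ) + 1 := by push_cast; ring
      rw [e1] at hmem
      exact hmem.1

/-- **Sliced agreement on a cylinder**: if for every `t ∈ (0, T)` the DSS identity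
`f (t/c², x/c) = b • f (t, x)` holds for a.e. `x ∈ B_r` (`c > 1`, `T, r > 0`), then for every
`t ∈ (0, T)` the scaling-invariant extension of `f` from the top layer of `(0,T) × B_r` agrees with
`f (t, ·)` a.e. on `B_r` — for *every* time slice, as the every-`t` datum clause of
`IsBradshawTsai2019LocalSolution` requires. [folklore] -/
theorem dssExtend_slice_ae_eq (hc : 1 < c) {T r : ℝ} (hT : 0 < T) (hr : 0 < r)
    (hsl : ∀ t ∈ Ioo (0 : ℝ) T, ∀ᵐ x ∂volume, x ∈ ball (0 : E) r →
      f (stDilate c (-1) (t, x)) = b • f (t, x))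
    {t : ℝ} (ht : t ∈ Ioo (0 : ℝ) T) :
    ∀ᵐ x ∂volume, x ∈ ball (0 : E) r →
      dssExtend c b (Ioo (0 : ℝ) T ×ˢ ball (0 : E) r) f (t, x) = f (t, x) := by
  have hc0 : 0 < c := one_pos.trans hc
  have hc0' : c ≠ 0 := hc0.ne'
  have hW := stDilate_neg_one_mem_cylinder (E := E) hc.le T r
  filter_upwards [slice_ae_forall_eq_pow_smul hc hsl t] with x hx hxr
  have hzW : ((t, x) : ℝ × E) ∈ Ioo (0 : ℝ) T ×ˢ ball (0 : E) r := ⟨ht, hxr⟩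
  obtain ⟨j, hj⟩ := exists_stDilate_mem_topLayer_cylinder (E := E) hc hT hr (z := (t, x)) ht.1
  obtain ⟨n, rfl⟩ := Int.eq_ofNat_of_zero_le (index_nonneg_of_mem hc0' hW hzW hj)
  rw [dssExtend_eq_of_mem hc0' hW hj, zpow_natCast, hx n hj.1]

end AE

end BradshawTsai2019

end Literature.Analysis.FluidPDE

end
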